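import Summits.BirchSwinnertonDyer.Rank1Residual.GaloisImage.NonsplitMultiplicativeUnramifiedPrelims
import Literature.NumberTheory.EllipticCurves.GeomPointsGaloisModule
import HarnessLib

/-!
# Unramified `p`-torsion classes die in `H¹(K_v, E)` at a NON-SPLIT multiplicative place (`p` odd)
# (cell `b2b-bsdres`, team n1011, row T-NSK = route planner 1's kind (iv′), ROUTE-1 §41.9; seat p04
# GEN 10; skeleton `cells/n1011/skel/T-NSK.md`)

HONEST FRAMING (cell `b2b-bsdres`, run/shared/lean/b2b/bsd-rank1-residual/, verbatim in every
file): the goal of the cell is to DELETE the COMBINATION-SHAPED residual classes of the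
Birch–Swinnerton-Dyer formula for ALL analytic-rank `≤ 1` elliptic curves over `ℚ` — "full BSD
formula for every rank `≤ 1` curve in class `C`" assembled STRICTLY from published theorems — so
that the rank-`≤ 1` remainder becomes exactly the CONSTRUCTION-SHAPED classes, which are TYPED
(missing-input `Prop`s), NOT attempted. This is not "finishing BSD". Team n1011 (N10 / N11, the
additive block X4 ∧ `p = 3`): research route on the CONSTRUCTION-SHAPED class X4; no claim beyond
the stated classes; nothing is booked; no mark / label / count is changed by this file. Theorems
only (no definition, no new named fact, no `sorry`); the statements are general (any number field
`K`, any finite place `v`, any odd `p`) and cell-independent. The main theorem is CONDITIONAL on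
the registered named fact `Literature.NumberTheory.EllipticCurves.Silverman1994_thmV53_corV54_tateUniformisation`
(Tate's `v`-adic uniformisation in the twisted form of Silverman, *ATAEC*, Ch. V, Lemma 5.2 (c),
Thm. 5.3, Cor. 5.4; file `TateUniformisation.lean`; the cell's A41), taken as the hypothesis `hU2`
exactly as in `CongruenceVisibilityMultiplicativeTwisted.lean`.

## What

The tree proves "unramified ⟹ local Selmer condition" (`unramifiedKer (E[n]) 𝔓 ≤ 𝓢_v(E)`, Gross
1991 (7.1) / Milne *ADT* I Prop. 3.8) only at places of GOOD reduction
(`WeierstrassCurve.unramifiedKer_le_selmerLocalKer`, from `Milne2006_unramifiedClass_eq_zero_holds`: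
a continuous crossed homomorphism `Γ_{K_v} → E(K̄_v)` vanishing on the inertia group is principal).
At a place of BAD reduction the corresponding statement is Milne's Prop. I.3.8 in its general form,
`H¹(K_v^nr/K_v, E(K_v^nr)) = H¹(k_v, Φ_v)` (`Φ_v` the component group), whose `p`-part vanishes iff
`p ∤ #(Φ_v(k̄_v)/(F - 1))`; for NON-SPLIT multiplicative reduction of type `I_n` the Frobenius acts
by `-1` on `Φ_v(k̄_v) ≅ ℤ/n`, so the quotient has order `gcd(2, n)` and its `p`-part is `0` for
every odd `p` and EVERY `n` (Tamagawa number `1` or `2`; Silverman *AEC* App. C §15, Table 15.1) —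
no condition on `ord_v Δ`, on `c_v`, on `E(K_v)[p]` or on the residue characteristic.

This file proves that statement in cocycle form, for `p`-torsion-valued cocycles:

* `NonsplitKummer.exists_eq_smul_sub_of_nonsplit` — for an elliptic curve `E = W` over a number
  field `K`, a finite place `v` (any residue characteristic) of multiplicative reduction with
  `γ(E/K) = -c₄/c₆` NOT a square in `K_v` (⟺ non-split, Silverman *ATAEC* V.5.3 (b); the
  non-square form is what a consumer certifies numerically), an odd `p`, and a prime `𝔐` of the
  local absolute integers above `𝓂_v`: every crossed homomorphism `g : Γ_{K_v} → E(K̄_v)` with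
  open zero set (e.g. a continuous cocycle), `g|_{I_𝔐} = 0` and `p • g = 0` is principal,
  `g = ∂b` — so its class in `H¹(K_v, E)` is trivial (the `oneCocycleClass` form and the global
  consequences are in the sequel).

The sequel `NonsplitMultiplicativeUnramifiedSelmer.lean` turns this into
`unramifiedKer (E[p]) 𝔓 ≤ selmerLocalKer W K_v p` and into the comparison-index criterion
`ι_v(θ) = 1` of `CongruenceVisibilityComparison.lean` ("kind (iv′)": `E` non-split multiplicative
at `v ∤ p`, the `p`-congruent partner good at `v`), the producer route planner 1 asked for
(ROUTE-1 §41.9/§41.11: 268 + 147 N11 rows).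

## Proof (from `hU2` alone; six steps, `skel/T-NSK.md` §0; details in the theorem's docstring)

`hU2` gives `q`, `t = √γ` and `Ψ : K̄_v^* ↠ E(K̄_v)` with kernel `q^ℤ`, `σ • Ψ(u) = Ψ((σu)^{±1})`
according as `σt = ±t`; non-split = some `σ₀` has `σ₀ t = -t`. (S1) a local Frobenius `F` with
`F t = -t` (prelims `exists_isArithFrobAt_apply_ne`); (S2) with `2k = p + 1` and `x = -k·f(F)`
(`p`-torsion, `I_𝔐`-invariant) the cohomologous `f′ = f - ∂x` has `f′(F) ∈ Ψ(μ_p)`; (S3) the `σ`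
with `f′(σ) ∈ Ψ(μ_p)` form an open subgroup containing `F` and `I_𝔐`, hence everything
(`eq_top_of_isOpen_of_frobenius_mem_of_inertia_le`); (S4) `f′ = Ψ ∘ ξ` for a unique continuous
`ξ : Γ → μ_p`, an honest cocycle on `H = Stab t`; (S5) Hilbert 90 for `K̄_v / K_v(t)`
(`AlgEquiv.exists_smul_div_eq_of_isOpen`, transported by `continuous_restrictScalars`):
`f′|_H = ∂Ψ(β)`; (S6) the residual class on `Γ/H ≅ ℤ/2` is killed by `2` and by `p`, hence by
`1 = 2k - p`: explicitly `f = ∂(x + Ψ(β) - k·f″(σ₀) + p·Ψ(β))`. No use is made of `v ∤ p`, of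
`ord_v q`, of "`K_v(t)/K_v` unramified" (not vendored), or of `p` prime.

## References

* [MilneADT2006] J. S. Milne, *Arithmetic Duality Theorems*, 2nd ed. (2006), Ch. I Prop. 3.8
  (general form `H¹(G/I, A(K^un)) = H¹(G/I, π₀(𝒜₀))`, p. 47; held copy PDF pp. 54–55).
* [SilvermanATAEC1994] J. H. Silverman, *Advanced Topics in the Arithmetic of Elliptic Curves*,
  GTM 151 (1994), Ch. V, Lemma 5.2 (c), Thm. 5.3, Cor. 5.4.
* [SilvermanAEC2009] J. H. Silverman, *The Arithmetic of Elliptic Curves*, 2nd ed., App. C §15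
  (Table 15.1: `c_v ∈ {1, 2}` for non-split `I_n`), X.§4.
* [Serre1979] J.-P. Serre, *Local Fields*, Ch. X §1 Prop. 2 (Hilbert 90 for infinite extensions).
* K. Česnavičius, *Selmer groups as flat cohomology groups*, J. Ramanujan Math. Soc. 31 (2016),
  Prop. 2.7 (b) (`H¹_nr ⊆ Im κ` when `deg φ` is prime to `c_A`) — provenance of the statement; NOT
  used (the non-split case needs no Tamagawa hypothesis and is proved here from `hU2`).

## Design

`noncomputable section`; universe `0` for `K` (the Tate fact is consumed at `.{0}`, as in
`CongruenceVisibilityMultiplicative*.lean`); no local notation (the Galois action on `K̄_v` is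
written `absoluteGaloisGroup.toAlgEquiv K_v σ`, on `K̄_vˣ` through `Units.map`, hence the long
lines); heartbeats raised (`400000`) for the main theorem only. Axioms: `propext`,
`Classical.choice`, `Quot.sound`.
-/

noncomputable section

open scoped Classical Topology
open Field NumberField IsDedekindDomain WeierstrassCurve
open Literature.NumberTheory.EllipticCurves Literature.NumberTheory.GaloisRepresentations

namespace Summit.BirchSwinnertonDyer.Rank1Residual.GaloisImage

namespace NonsplitKummer

/-! ### §1. The local theorem -/

section Local

variable {K : Type} [Field K] [NumberField K] (W : WeierstrassCurve K) [W.IsElliptic]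
  (v : HeightOneSpectrum (𝓞 K))


set_option maxHeartbeats 400000 in
/-- **Unramified `p`-torsion classes die in `H¹((v.adicCompletion K), E)` at a non-split multiplicative place, `p`
odd** — the cocycle form of Milne, *ADT*, Prop. I.3.8 at a place of NON-SPLIT multiplicative
reduction: a continuous crossed homomorphism `f : Γ_{(v.adicCompletion K)} → E(K̄_v)` vanishing on the inertia group
`I_𝔐` and with `p`-torsion values, `p` odd, has trivial class, provided `γ(E/K) = -c₄/c₆` is not a
square in `(v.adicCompletion K)` (under multiplicative reduction: `E` is NOT split at `v`, Silverman *ATAEC*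
V.5.3 (b); equivalently the Tate parametrisation of Cor. V.5.4 is genuinely twisted).  No hypothesis
on the residue characteristic of `v` (`v ∣ p` allowed), on `ord_v Δ`, on the Tamagawa number or on
`E((v.adicCompletion K))[p]`.  Conditional on the named fact `Silverman1994_thmV53_corV54_tateUniformisation`
(`hU2`; Silverman, *ATAEC*, V.5.2 (c), V.5.3, V.5.4).  Classical content: `H¹((v.adicCompletion K)^nr/(v.adicCompletion K), E)` is
`H¹(k_v, Φ_v)` (Milne I.3.8), and for non-split `I_n` the Frobenius acts by `-1` on
`Φ_v(k̄_v) ≅ ℤ/n`, so `(Φ_v/(F-1)Φ_v)[p] = 0` for odd `p` (Tamagawa number `1` or `2`, Silverman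
*AEC* App. C §15, Table 15.1).  PROOF here (from `hU2` alone, `σ • Ψ(u) = Ψ((σu)^{±1})` according
as `σ√γ = ±√γ`): a local Frobenius `F` with `F√γ = -√γ` (density of `⟨F, I_𝔐⟩`); replacing `g`
by `g - ∂x`, `x = -k·g(F)`, `2k = p + 1`, makes `g(F) ∈ Ψ(μ_p)`, hence `g(σ) ∈ Ψ(μ_p)` for all
`σ` (the set of such `σ` is an open subgroup containing `F` and `I_𝔐`); on `H = Stab(√γ)` the
lift `ξ : H → μ_p` is an honest continuous cocycle, principal by Hilbert 90
(`AlgEquiv.exists_smul_div_eq_of_isOpen` for `K̄_v/(v.adicCompletion K)(√γ)`); the residual class on `Γ/H ≅ ℤ/2`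
is killed by `2` and by `p`, hence by `1 = 2k - p`. [cite: MilneADT2006, Ch. I Prop. 3.8]
[cite: SilvermanATAEC1994, Ch. V Lemma 5.2 (c), Thm. 5.3, Cor. 5.4]
[cite: SilvermanAEC2009, App. C §15 Table 15.1] -/
theorem exists_eq_smul_sub_of_nonsplit
    (hU2 : Silverman1994_thmV53_corV54_tateUniformisation.{0})
    (hW : W.HasMultiplicativeReductionAt v)
    (hγ : ¬ IsSquare (algebraMap K (v.adicCompletion K) (-(W.c₄ / W.c₆))))
    {p : ℕ} (hp : Odd p) {𝔐 : Ideal (v.localAbsIntegers)} (h𝔐 : 𝔐 ∈ v.localPrimesAbove)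
    (g : (absoluteGaloisGroup (v.adicCompletion K)) → localPoints W (v.adicCompletion K))
    (hg : ∀ σ τ, g (σ * τ) = g σ + σ • g τ) (hopen : IsOpen {σ | g σ = 0})
    (hgI : ∀ σ ∈ 𝔐.inertia (absoluteGaloisGroup (v.adicCompletion K)), g σ = 0)
    (hpg : ∀ σ, (p : ℤ) • g σ = 0) :
    ∃ b : localPoints W (v.adicCompletion K), ∀ σ, g σ = σ • b - b := by
  classical
  -- arithmetic of `p = 2k' - 1`
  obtain ⟨k, hk⟩ := hp
  obtain ⟨k', hpk⟩ : ∃ k' : ℤ, (p : ℤ) = 2 * k' - 1 := ⟨k + 1, by rw [hk]; push_cast; ring⟩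
  have hp0 : p ≠ 0 := by omega
  haveI : CharZero (v.adicCompletion K) := charZero_of_injective_algebraMap (algebraMap K (v.adicCompletion K)).injective
  haveI : CharZero (AlgebraicClosure (v.adicCompletion K)) := charZero_of_injective_algebraMap (algebraMap (v.adicCompletion K) (AlgebraicClosure (v.adicCompletion K))).injective
  -- the twisted Tate parametrisation at `v`
  obtain ⟨q, t, Ψ, hq0, hq1, ht0, ht2, hsurj, hker, hequiv₀, -⟩ := hU2 W v hW
  have hε : ∀ (σ : (absoluteGaloisGroup (v.adicCompletion K))) (u : (AlgebraicClosure (v.adicCompletion K))ˣ), σ • Ψ (Additive.ofMul u) =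
      Ψ (Additive.ofMul (((Units.map (absoluteGaloisGroup.toAlgEquiv (v.adicCompletion K) σ : AlgebraicClosure (v.adicCompletion K) →* AlgebraicClosure (v.adicCompletion K))) u) ^ (if (absoluteGaloisGroup.toAlgEquiv (v.adicCompletion K) σ) t = t then (1 : ℤ) else -1))) := by
    intro σ u
    rw [hequiv₀ σ u, ofMul_zpow, map_zsmul]
  -- `σ t = ± t`
  have hσt : ∀ σ : (absoluteGaloisGroup (v.adicCompletion K)), (absoluteGaloisGroup.toAlgEquiv (v.adicCompletion K) σ) t = t ∨ (absoluteGaloisGroup.toAlgEquiv (v.adicCompletion K) σ) t = -t := fun σ ↦ by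
    apply sq_eq_sq_iff_eq_or_eq_neg.mp
    rw [← map_pow, ht2, AlgEquiv.commutes]
  have hneg : ∀ σ : (absoluteGaloisGroup (v.adicCompletion K)), (absoluteGaloisGroup.toAlgEquiv (v.adicCompletion K) σ) t ≠ t → (absoluteGaloisGroup.toAlgEquiv (v.adicCompletion K) σ) t = -t := fun σ h ↦ (hσt σ).resolve_left h
  have htne : -t ≠ t := by
    intro e
    have h2 : (2 : (AlgebraicClosure (v.adicCompletion K))) * t = 0 := by linear_combination -e
    rcases mul_eq_zero.mp h2 with h | h
    · exact two_ne_zero h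
    · exact ht0 h
  -- NON-SPLIT: some `σ₀` moves `t`
  obtain ⟨σ₀, hσ₀⟩ : ∃ σ₀ : (absoluteGaloisGroup (v.adicCompletion K)), (absoluteGaloisGroup.toAlgEquiv (v.adicCompletion K) σ₀) t ≠ t := by
    by_contra hall
    push Not at hall
    haveI : ExpChar (v.adicCompletion K) 1 := ExpChar.zero
    obtain ⟨m, y, hy⟩ :=
      Literature.NumberTheory.GaloisRepresentations.absoluteGaloisGroup.exists_algebraMap_eq_pow_of_forall_smul_eq
        (v.adicCompletion K) 1 (x := t) (fun σ ↦ hall σ)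
    rw [one_pow, pow_one] at hy
    refine hγ ⟨y, (algebraMap (v.adicCompletion K) (AlgebraicClosure (v.adicCompletion K))).injective ?_⟩
    rw [map_mul, hy, ← sq, ht2]
  have hσ₀t : (absoluteGaloisGroup.toAlgEquiv (v.adicCompletion K) σ₀) t = -t := hneg σ₀ hσ₀
  -- a local Frobenius `F` at `𝔐` moving `t`
  haveI hInormal := v.inertia_normal_of_mem_localPrimesAbove h𝔐
  obtain ⟨F, hF, hFt⟩ := exists_isArithFrobAt_apply_ne v h𝔐 hσt htne ⟨σ₀, hσ₀⟩
  have hεF : (if (absoluteGaloisGroup.toAlgEquiv (v.adicCompletion K) F) t = t then (1 : ℤ) else -1) = -1 := if_neg hFt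
  -- (S2) renormalisation: `x = -k' • g F`, `f' = g - ∂x`
  have hmI : ∀ τ ∈ 𝔐.inertia (absoluteGaloisGroup (v.adicCompletion K)), τ • g F = g F := fun τ hτ ↦
    smul_eq_of_normal hg hInormal hgI F hτ
  set x : localPoints W (v.adicCompletion K) := -(k' • g F) with hx
  have hxI : ∀ τ ∈ 𝔐.inertia (absoluteGaloisGroup (v.adicCompletion K)), τ • x = x := fun τ hτ ↦ by
    rw [hx, smul_neg, W.smul_zsmul_localPoints k' τ (g F), hmI τ hτ]
  have hpx : (p : ℤ) • x = 0 := by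
    rw [hx, smul_neg, smul_comm, hpg F, smul_zero, neg_zero]
  set f' : (absoluteGaloisGroup (v.adicCompletion K)) → localPoints W (v.adicCompletion K) := fun σ ↦ g σ - (σ • x - x) with hf'def
  have hf' : ∀ σ τ, f' (σ * τ) = f' σ + σ • f' τ := crossedHom_sub_coboundary hg x
  have hf'I : ∀ τ ∈ 𝔐.inertia (absoluteGaloisGroup (v.adicCompletion K)), f' τ = 0 := fun τ hτ ↦ by
    simp only [hf'def, hgI τ hτ, hxI τ hτ, sub_self]
  have hpf' : ∀ σ, (p : ℤ) • f' σ = 0 := fun σ ↦ by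
    simp only [hf'def]
    rw [smul_sub, smul_sub, hpg σ, ← W.smul_zsmul_localPoints (p : ℤ) σ x, hpx, smul_zero,
      sub_self, sub_zero]
  -- `g F = Ψ u`, `u ^ p = Q ^ j` with `Q = q` as a unit of `K̄_v`
  obtain ⟨uA, huA⟩ := hsurj (g F)
  set u : (AlgebraicClosure (v.adicCompletion K))ˣ := Additive.toMul uA with hu
  have hum : Ψ (Additive.ofMul u) = g F := by rw [hu, ofMul_toMul]; exact huA
  have hq' : algebraMap (v.adicCompletion K) (AlgebraicClosure (v.adicCompletion K)) q ≠ 0 := (map_ne_zero _).mpr hq0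
  set Q : (AlgebraicClosure (v.adicCompletion K))ˣ := Units.mk0 (algebraMap (v.adicCompletion K) (AlgebraicClosure (v.adicCompletion K)) q) hq' with hQ
  have hQgal : ∀ σ : (absoluteGaloisGroup (v.adicCompletion K)), (Units.map (absoluteGaloisGroup.toAlgEquiv (v.adicCompletion K) σ : AlgebraicClosure (v.adicCompletion K) →* AlgebraicClosure (v.adicCompletion K))) Q = Q := fun σ ↦ Units.ext (by
    rw [Units.coe_map, MonoidHom.coe_coe, hQ, Units.val_mk0, AlgEquiv.commutes])
  have hQΨ : Ψ (Additive.ofMul Q) = 0 :=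
    (hker Q).mpr ⟨1, by rw [zpow_one, hQ, Units.val_mk0]⟩
  obtain ⟨j, hj⟩ : ∃ j : ℤ, u ^ (p : ℤ) = Q ^ j := by
    have h0 : Ψ (Additive.ofMul (u ^ p)) = 0 := by
      rw [ofMul_pow, map_nsmul, hum, ← natCast_zsmul, hpg F]
    obtain ⟨j, hj⟩ := (hker _).mp h0
    refine ⟨j, Units.ext ?_⟩
    rw [zpow_natCast, hj, Units.val_zpow_eq_zpow_val, hQ, Units.val_mk0]
  -- `f' F = Ψ u'` with `u' ^ p = 1`
  set u' : (AlgebraicClosure (v.adicCompletion K))ˣ := u ^ (1 - k') * ((Units.map (absoluteGaloisGroup.toAlgEquiv (v.adicCompletion K) F : AlgebraicClosure (v.adicCompletion K) →* AlgebraicClosure (v.adicCompletion K))) u) ^ (-k') * Q ^ j with hu'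
  have hf'F : f' F = Ψ (Additive.ofMul u') := by
    have hB : F • g F = -Ψ (Additive.ofMul ((Units.map (absoluteGaloisGroup.toAlgEquiv (v.adicCompletion K) F : AlgebraicClosure (v.adicCompletion K) →* AlgebraicClosure (v.adicCompletion K))) u)) := by
      rw [← hum, hε F u, hεF, zpow_neg, zpow_one, ofMul_inv, map_neg]
    have hR : Ψ (Additive.ofMul u') =
        (1 - k') • g F + (-k') • Ψ (Additive.ofMul ((Units.map (absoluteGaloisGroup.toAlgEquiv (v.adicCompletion K) F : AlgebraicClosure (v.adicCompletion K) →* AlgebraicClosure (v.adicCompletion K))) u)) := by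
      rw [hu', ofMul_mul, ofMul_mul, map_add, map_add, ofMul_zpow, ofMul_zpow, ofMul_zpow,
        map_zsmul, map_zsmul, map_zsmul, hum, hQΨ, smul_zero, add_zero]
    rw [hR]
    simp only [hf'def]
    rw [hx, smul_neg, W.smul_zsmul_localPoints k' F (g F), hB]
    module
  have hu'p : u' ^ p = 1 := by
    have e1 : ((Units.map (absoluteGaloisGroup.toAlgEquiv (v.adicCompletion K) F : AlgebraicClosure (v.adicCompletion K) →* AlgebraicClosure (v.adicCompletion K))) u) ^ (p : ℤ) = Q ^ j := by rw [← map_zpow, hj, map_zpow, hQgal]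
    rw [← zpow_natCast, hu', mul_zpow, mul_zpow, ← zpow_mul, ← zpow_mul, ← zpow_mul,
      mul_comm (1 - k') (p : ℤ), zpow_mul, hj, mul_comm (-k') (p : ℤ), zpow_mul, e1,
      ← zpow_mul, ← zpow_mul, ← zpow_add, ← zpow_add, hpk,
      show j * (1 - k') + j * -k' + j * (2 * k' - 1) = 0 by ring, zpow_zero]
  -- (S3) every value of `f'` lies on the line `Ψ(μ_p)`
  obtain ⟨Z, hZ⟩ := exists_subgroup_coe_eq_zeroSet hf'
  have hZmem : ∀ σ, σ ∈ Z ↔ f' σ = 0 := fun σ ↦ by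
    rw [← SetLike.mem_coe, hZ, Set.mem_setOf_eq]
  have hZopen : IsOpen (Z : Set (absoluteGaloisGroup (v.adicCompletion K))) := by
    apply Z.isOpen_of_mem_nhds (g := 1)
    have h1 : {σ | g σ = 0} ∈ 𝓝 (1 : (absoluteGaloisGroup (v.adicCompletion K))) :=
      hopen.mem_nhds (crossedHom_one hg)
    have h2 : ((MulAction.stabilizer (absoluteGaloisGroup (v.adicCompletion K)) x : Subgroup (absoluteGaloisGroup (v.adicCompletion K))) : Set (absoluteGaloisGroup (v.adicCompletion K))) ∈ 𝓝 (1 : (absoluteGaloisGroup (v.adicCompletion K))) :=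
      (W.isOpen_stabilizer_localPoints (v.adicCompletion K) x).mem_nhds (one_mem _)
    refine Filter.mem_of_superset (Filter.inter_mem h1 h2) fun σ hσ ↦ ?_
    obtain ⟨hσ1, hσ2⟩ := hσ
    rw [Set.mem_setOf_eq] at hσ1
    rw [SetLike.mem_coe, MulAction.mem_stabilizer_iff] at hσ2
    rw [SetLike.mem_coe, hZmem]
    simp only [hf'def, hσ2, sub_self, sub_zero]
    exact hσ1
  obtain ⟨A, hA⟩ := exists_subgroup_coe_eq_setOf_mem_line W v Ψ
    (fun σ ↦ if (absoluteGaloisGroup.toAlgEquiv (v.adicCompletion K) σ) t = t then (1 : ℤ) else -1) (fun σ u ↦ hε σ u) hf' p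
  have hAmem : ∀ σ, σ ∈ A ↔ ∃ ζ : (AlgebraicClosure (v.adicCompletion K))ˣ, ζ ^ p = 1 ∧ f' σ = Ψ (Additive.ofMul ζ) := fun σ ↦ by
    rw [← SetLike.mem_coe, hA, Set.mem_setOf_eq]
  have hZA : Z ≤ A := fun σ hσ ↦
    (hAmem σ).mpr ⟨1, one_pow _, by rw [(hZmem σ).mp hσ, ofMul_one, map_zero]⟩
  have hAopen : IsOpen (A : Set (absoluteGaloisGroup (v.adicCompletion K))) :=
    A.isOpen_of_mem_nhds (g := 1) (Filter.mem_of_superset (hZopen.mem_nhds Z.one_mem) hZA)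
  have hFA : F ∈ A := (hAmem F).mpr ⟨u', hu'p, hf'F⟩
  have hIA : 𝔐.inertia (absoluteGaloisGroup (v.adicCompletion K)) ≤ A := fun τ hτ ↦
    (hAmem τ).mpr ⟨1, one_pow _, by rw [hf'I τ hτ, ofMul_one, map_zero]⟩
  have hAtop : A = ⊤ := v.eq_top_of_isOpen_of_frobenius_mem_of_inertia_le h𝔐 hF hAopen hFA hIA
  choose ξ hξp hξ using fun σ ↦ (hAmem σ).mp (hAtop ▸ Subgroup.mem_top σ)
  -- (S4) the lift `ξ : (absoluteGaloisGroup (v.adicCompletion K)) → μ_p`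
  have huniq : ∀ (ζ₁ ζ₂ : (AlgebraicClosure (v.adicCompletion K))ˣ), ζ₁ ^ p = 1 → ζ₂ ^ p = 1 →
      Ψ (Additive.ofMul ζ₁) = Ψ (Additive.ofMul ζ₂) → ζ₁ = ζ₂ :=
    fun ζ₁ ζ₂ h₁ h₂ h ↦ eq_of_pow_eq_one_of_map_ofMul_eq W v hq0 hq1 Ψ hker hp0 h₁ h₂ h
  have hξ1 : ∀ σ, f' σ = 0 → ξ σ = 1 := fun σ h0 ↦
    huniq _ _ (hξp σ) (one_pow _) (by rw [← hξ σ, h0, ofMul_one, map_zero])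
  have hξ1' : ∀ σ, ξ σ = 1 → f' σ = 0 := fun σ h1 ↦ by rw [hξ σ, h1, ofMul_one, map_zero]
  have hξmul : ∀ σ τ : (absoluteGaloisGroup (v.adicCompletion K)), (absoluteGaloisGroup.toAlgEquiv (v.adicCompletion K) σ) t = t → ξ (σ * τ) = ξ σ * (Units.map (absoluteGaloisGroup.toAlgEquiv (v.adicCompletion K) σ : AlgebraicClosure (v.adicCompletion K) →* AlgebraicClosure (v.adicCompletion K))) (ξ τ) := by
    intro σ τ hσt'
    refine huniq _ _ (hξp _) ?_ ?_
    · rw [mul_pow, hξp, one_mul, ← map_pow, hξp, map_one]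
    · rw [← hξ, hf', hξ σ, hξ τ, hε σ, if_pos hσt', zpow_one, ofMul_mul, map_add]
  -- (S5) Hilbert 90 on `H = Gal(K̄_v / (v.adicCompletion K)(t))`
  set L₀ : IntermediateField (v.adicCompletion K) (AlgebraicClosure (v.adicCompletion K)) := IntermediateField.adjoin (v.adicCompletion K) {t} with hL₀
  have htL₀ : t ∈ L₀ := IntermediateField.mem_adjoin_simple_self (v.adicCompletion K) t
  haveI : Normal L₀ (AlgebraicClosure (v.adicCompletion K)) := Normal.tower_top_of_normal (v.adicCompletion K) L₀ (AlgebraicClosure (v.adicCompletion K))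
  have hιt : ∀ e : (AlgebraicClosure (v.adicCompletion K)) ≃ₐ[L₀] (AlgebraicClosure (v.adicCompletion K)),
      (absoluteGaloisGroup.toAlgEquiv (v.adicCompletion K) ((absoluteGaloisGroup.toAlgEquiv (v.adicCompletion K)).symm (e.restrictScalars (v.adicCompletion K)))) t = t := by
    intro e
    rw [MulEquiv.apply_symm_apply, AlgEquiv.restrictScalars_apply]
    exact e.commutes (⟨t, htL₀⟩ : L₀)
  set fH : ((AlgebraicClosure (v.adicCompletion K)) ≃ₐ[L₀] (AlgebraicClosure (v.adicCompletion K))) → (AlgebraicClosure (v.adicCompletion K))ˣ :=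
    fun e ↦ ξ ((absoluteGaloisGroup.toAlgEquiv (v.adicCompletion K)).symm (e.restrictScalars (v.adicCompletion K))) with hfH
  have hfHcoc : ∀ e e', fH (e * e') = e • fH e' * fH e := by
    intro e e'
    simp only [hfH]
    rw [show (e * e').restrictScalars (v.adicCompletion K) = e.restrictScalars (v.adicCompletion K) * e'.restrictScalars (v.adicCompletion K) from
      by ext; rfl, map_mul, hξmul _ _ (hιt e), mul_comm, AlgEquiv.smul_units_def]
    rfl
  have hfHopen : IsOpen {e | fH e = 1} := by
    have hset : {e : (AlgebraicClosure (v.adicCompletion K)) ≃ₐ[L₀] (AlgebraicClosure (v.adicCompletion K)) | fH e = 1} =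
        (fun e ↦ (absoluteGaloisGroup.toAlgEquiv (v.adicCompletion K)).symm (e.restrictScalars (v.adicCompletion K))) ⁻¹'
          (Z : Set (absoluteGaloisGroup (v.adicCompletion K))) := by
      ext e
      simp only [Set.mem_setOf_eq, Set.mem_preimage, SetLike.mem_coe, hZmem, hfH]
      exact ⟨hξ1' _, hξ1 _⟩
    rw [hset]
    exact hZopen.preimage (continuous_restrictScalars (v.adicCompletion K) L₀)
  obtain ⟨β, hβ⟩ := AlgEquiv.exists_smul_div_eq_of_isOpen fH hfHcoc hfHopen
  set P : localPoints W (v.adicCompletion K) := Ψ (Additive.ofMul β) with hP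
  have hPH : ∀ σ : (absoluteGaloisGroup (v.adicCompletion K)), (absoluteGaloisGroup.toAlgEquiv (v.adicCompletion K) σ) t = t → f' σ = σ • P - P := by
    intro σ hσt'
    have hfix : ∀ y ∈ L₀, (absoluteGaloisGroup.toAlgEquiv (v.adicCompletion K) σ) y = y :=
      (IntermediateField.forall_mem_adjoin_smul_eq_self_iff (v.adicCompletion K) (S := ({t} : Set (AlgebraicClosure (v.adicCompletion K))))
        (absoluteGaloisGroup.toAlgEquiv (v.adicCompletion K) σ)).mpr (by simpa using hσt')
    let e : (AlgebraicClosure (v.adicCompletion K)) ≃ₐ[L₀] (AlgebraicClosure (v.adicCompletion K)) := { (absoluteGaloisGroup.toAlgEquiv (v.adicCompletion K) σ : (AlgebraicClosure (v.adicCompletion K)) ≃ₐ[(v.adicCompletion K)] (AlgebraicClosure (v.adicCompletion K))) with commutes' := fun y ↦ hfix y y.2 }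
    have he : (absoluteGaloisGroup.toAlgEquiv (v.adicCompletion K)).symm (e.restrictScalars (v.adicCompletion K)) = σ := by
      apply (absoluteGaloisGroup.toAlgEquiv (v.adicCompletion K)).injective
      rw [MulEquiv.apply_symm_apply]
      ext y
      rfl
    have hmap : Units.map (e : (AlgebraicClosure (v.adicCompletion K)) →* (AlgebraicClosure (v.adicCompletion K))) β = (Units.map (absoluteGaloisGroup.toAlgEquiv (v.adicCompletion K) σ : AlgebraicClosure (v.adicCompletion K) →* AlgebraicClosure (v.adicCompletion K))) β :=
      Units.ext (by rw [Units.coe_map, Units.coe_map, MonoidHom.coe_coe, MonoidHom.coe_coe]; rfl)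
    have h1 : ξ σ = (Units.map (absoluteGaloisGroup.toAlgEquiv (v.adicCompletion K) σ : AlgebraicClosure (v.adicCompletion K) →* AlgebraicClosure (v.adicCompletion K))) β / β := by
      rw [← hmap, ← AlgEquiv.smul_units_def, hβ e, hfH]; simp only; rw [he]
    rw [hξ σ, h1, ofMul_div, map_sub, hP, hε σ β, if_pos hσt', zpow_one]
  -- (S6) descent along `(absoluteGaloisGroup (v.adicCompletion K)) / H ≅ ℤ/2`
  set f'' : (absoluteGaloisGroup (v.adicCompletion K)) → localPoints W (v.adicCompletion K) := fun σ ↦ f' σ - (σ • P - P) with hf''def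
  have hf'' : ∀ σ τ, f'' (σ * τ) = f'' σ + σ • f'' τ := crossedHom_sub_coboundary hf' P
  have hf''H : ∀ σ : (absoluteGaloisGroup (v.adicCompletion K)), (absoluteGaloisGroup.toAlgEquiv (v.adicCompletion K) σ) t = t → f'' σ = 0 := fun σ h ↦ by
    simp only [hf''def, hPH σ h, sub_self]
  set z₀ : localPoints W (v.adicCompletion K) := -((p : ℤ) • P) with hz₀
  have hpf'' : ∀ σ, (p : ℤ) • f'' σ = σ • z₀ - z₀ := fun σ ↦ by
    simp only [hf''def, hz₀]
    rw [smul_sub, hpf' σ, smul_sub, ← W.smul_zsmul_localPoints (p : ℤ) σ P, smul_neg]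
    abel
  have hz₀H : ∀ σ : (absoluteGaloisGroup (v.adicCompletion K)), (absoluteGaloisGroup.toAlgEquiv (v.adicCompletion K) σ) t = t → σ • z₀ = z₀ := fun σ h ↦ by
    have h' := hpf'' σ; rw [hf''H σ h, smul_zero] at h'; exact (sub_eq_zero.mp h'.symm)
  have hσ₀sq : (absoluteGaloisGroup.toAlgEquiv (v.adicCompletion K) (σ₀ * σ₀)) t = t := by
    rw [map_mul, AlgEquiv.mul_apply, hσ₀t, map_neg, hσ₀t, neg_neg]
  have hσ₀y : σ₀ • f'' σ₀ = -f'' σ₀ := by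
    have h := hf'' σ₀ σ₀
    rw [hf''H _ hσ₀sq] at h
    exact eq_neg_of_add_eq_zero_right h.symm
  have hσ₀inv : (absoluteGaloisGroup.toAlgEquiv (v.adicCompletion K) σ₀⁻¹) t = -t := by
    have h : (absoluteGaloisGroup.toAlgEquiv (v.adicCompletion K) σ₀⁻¹) ((absoluteGaloisGroup.toAlgEquiv (v.adicCompletion K) σ₀) t) = t := by
      rw [← AlgEquiv.mul_apply, ← map_mul, inv_mul_cancel, map_one, AlgEquiv.one_apply]
    rw [hσ₀t, map_neg] at h
    exact neg_eq_iff_eq_neg.mp h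
  have hyH : ∀ τ : (absoluteGaloisGroup (v.adicCompletion K)), (absoluteGaloisGroup.toAlgEquiv (v.adicCompletion K) τ) t = t → τ • f'' σ₀ = f'' σ₀ := by
    intro τ hτ
    have hconj : (absoluteGaloisGroup.toAlgEquiv (v.adicCompletion K) (σ₀⁻¹ * τ * σ₀)) t = t := by
      rw [map_mul, map_mul, AlgEquiv.mul_apply, AlgEquiv.mul_apply, hσ₀t, map_neg, hτ, map_neg,
        hσ₀inv, neg_neg]
    have h1 : f'' (τ * σ₀) = τ • f'' σ₀ := by rw [hf'', hf''H τ hτ, zero_add]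
    have h2 : f'' (σ₀ * (σ₀⁻¹ * τ * σ₀)) = f'' σ₀ := by
      rw [hf'', hf''H _ hconj, smul_zero, add_zero]
    rw [show σ₀ * (σ₀⁻¹ * τ * σ₀) = τ * σ₀ by group] at h2
    rw [← h1, h2]
  set z : localPoints W (v.adicCompletion K) := -(k' • f'' σ₀) - z₀ with hz
  have hfz : ∀ σ : (absoluteGaloisGroup (v.adicCompletion K)), f'' σ = σ • z - z := by
    intro σ
    rcases hσt σ with hσ | hσ
    · rw [hf''H σ hσ, hz, smul_sub, smul_neg, W.smul_zsmul_localPoints k' σ (f'' σ₀), hyH σ hσ,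
        hz₀H σ hσ, sub_self]
    · have hh : (absoluteGaloisGroup.toAlgEquiv (v.adicCompletion K) (σ₀⁻¹ * σ)) t = t := by
        rw [map_mul, AlgEquiv.mul_apply, hσ, map_neg, hσ₀inv, neg_neg]
      have h1 : f'' σ = f'' σ₀ := by
        have h' := hf'' σ₀ (σ₀⁻¹ * σ)
        rw [mul_inv_cancel_left, hf''H _ hh, smul_zero, add_zero] at h'
        exact h'
      have hhz : (σ₀⁻¹ * σ) • z = z := by
        rw [hz, smul_sub, smul_neg, W.smul_zsmul_localPoints k' (σ₀⁻¹ * σ) (f'' σ₀), hyH _ hh,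
          hz₀H _ hh]
      have h2 : σ • z = σ₀ • z := by
        conv_lhs => rw [← mul_inv_cancel_left σ₀ σ, mul_smul, hhz]
      have h3 : σ₀ • z₀ = (p : ℤ) • f'' σ₀ + z₀ := by rw [hpf'' σ₀, sub_add_cancel]
      rw [h1, h2, hz, smul_sub, smul_neg, W.smul_zsmul_localPoints k' σ₀ (f'' σ₀), hσ₀y, h3, hpk]
      clear_value f' f''
      module
  -- (S7) conclusion: `f = ∂(x + P + z)`
  refine ⟨x + P + z, fun σ ↦ ?_⟩
  have e1 : g σ = f'' σ + (σ • P - P) + (σ • x - x) := by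
    simp only [hf''def, hf'def, sub_add_cancel]
  rw [e1, hfz σ, smul_add, smul_add]
  abel

end Local

end NonsplitKummer

end Summit.BirchSwinnertonDyer.Rank1Residual.GaloisImage

end
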